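import Literature.Topology.FourManifolds.BandCore
import Literature.Topology.FourManifolds.BandSumProofs
import HarnessLib

/-!
# Transport of a band core along a diffeomorphism fixing the two knots

Topic `Literature/Topology/FourManifolds`; fact seat `provefact-IsStrictHandleSlide.isSurgery`
(R. C. Kirby, *The Topology of 4-Manifolds*, LNM 1374 (1989), Ch. I §4; remaining content: the
named fact (S) `Literature.Topology.FourManifolds.FramedLink.IsStrictHandleSlide.slideModel`).
The normalisation of the end of the slide band (`KirbyMovesSlideEndStepA.lean`,
`KirbyMovesSlideEndStepB.lean`) moves the band by diffeomorphisms of `S³` which fix the two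
knots `A` (the attaching circle `Kᵢ`) and `Kⱼ'` (the push-off) pointwise; the moved band is
again a band core from `A` to `Kⱼ'`. This is the `BandCore` version of the tree's
`BandData.exists_map` (`BandSumProofs.lean`; same proof: set-theoretic clauses by injectivity,
immersion by the chain rule, orientations by `deriv_coe_comp_eq_smul_fderiv_coe_comp`), with the
pointwise fixing used to keep the same knots as indices. Proved here (no definitions, no named
facts):

* `Literature.Topology.FourManifolds.BandCore.exists_comp_of_fix` — for `c : BandCore K₁ K₂ avoid`
  and a diffeomorphism `φ` of `S³` with `φ ∘ K₁ = K₁`, `φ ∘ K₂ = K₂` pointwise, a band core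
  `c' : BandCore K₁ K₂ ∅` with `c'.band = φ ∘ c.band` and `c'.δ = c.δ`.

## References

* R. C. Kirby, *The Topology of 4-Manifolds*, LNM 1374, Springer (1989), Ch. I §4. [Kirby1989]
* D. Rolfsen, *Knots and Links* (1976), §2.G. [Rolfsen1976]
-/

open scoped Manifold ContDiff Topology
open Function Set Metric

noncomputable section

namespace Literature.Topology.FourManifolds

namespace BandCore

variable {K₁ K₂ : Knot} {avoid : Set (Metric.sphere (0 : EuclideanSpace ℝ (Fin 4)) 1)}

/-- **Transport of a band core along a diffeomorphism of `S³` fixing the two knots pointwise.**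
[folklore] -/
theorem exists_comp_of_fix (c : BandCore K₁ K₂ avoid)
    (φ : (Metric.sphere (0 : EuclideanSpace ℝ (Fin (3 + 1))) 1) ≃ₘ⟮𝓡 3, 𝓡 3⟯
      (Metric.sphere (0 : EuclideanSpace ℝ (Fin (3 + 1))) 1))
    (h₁ : ∀ u, φ (K₁ u) = K₁ u) (h₂ : ∀ u, φ (K₂ u) = K₂ u) :
    ∃ c' : BandCore K₁ K₂ ∅, c'.band = φ ∘ c.band ∧ c'.δ = c.δ := by
  have hφ : Injective ⇑φ := φ.injective
  have hr₁ : range (⇑φ ∘ ⇑K₁) = range ⇑K₁ := by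
    ext p; simp only [mem_range, comp_apply, h₁]
  have hr₂ : range (⇑φ ∘ ⇑K₂) = range ⇑K₂ := by
    ext p; simp only [mem_range, comp_apply, h₂]
  have hc₁ : (fun t ↦ φ (K₁ (circlePoint t))) = fun t ↦ K₁ (circlePoint t) := funext fun t ↦ h₁ _
  have hc₂ : (fun t ↦ φ (K₂ (circlePoint t))) = fun t ↦ K₂ (circlePoint t) := funext fun t ↦ h₂ _
  refine ⟨{ band := φ ∘ c.band, δ := c.δ, δ_pos := c.δ_pos, contMDiff := φ.contMDiff.comp c.contMDiff,
            injOn := hφ.comp_injOn c.injOn, injective_mfderiv := fun x hx ↦ ?_,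
            disjoint_avoid := disjoint_empty _, preimage_left := ?_, preimage_right := ?_,
            orient_left := ?_, orient_right := ?_ }, rfl, rfl⟩
  · have hn : (∞ : ℕ∞ω) ≠ 0 := by simp
    rw [mfderiv_comp x (φ.contMDiff.mdifferentiableAt hn) (c.contMDiff.mdifferentiableAt hn)]
    exact (φ.mfderivToContinuousLinearEquiv hn (c.band x)).injective.comp (c.injective_mfderiv x hx)
  · rw [← hr₁, preimage_comp_range_comp hφ, c.preimage_left]
  · rw [← hr₂, preimage_comp_range_comp hφ, c.preimage_right]
  · have hn : (∞ : ℕ∞ω) ≠ 0 := by simp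
    have := fact_finrank_euclideanSpace_succ 1
    have := fact_finrank_euclideanSpace_succ 3
    obtain ⟨θ, k, hk, hpt, hder⟩ := c.orient_left
    refine ⟨θ, k, hk, ?_, ?_⟩
    · rw [← h₁]; exact congrArg φ hpt
    · have h := deriv_coe_comp_eq_smul_fderiv_coe_comp (γ := fun t ↦ K₁ (circlePoint t)) φ.contMDiff
        ((K₁.contMDiff.comp (contDiff_coe_circlePoint.contMDiff.codRestrict_sphere
          fun t ↦ (circlePoint t).2)).mdifferentiableAt hn)
        (c.contMDiff.mdifferentiableAt hn) hpt hder
      simpa only [h₁, Function.comp_def] using h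
  · have hn : (∞ : ℕ∞ω) ≠ 0 := by simp
    have := fact_finrank_euclideanSpace_succ 1
    have := fact_finrank_euclideanSpace_succ 3
    obtain ⟨θ, k, hk, hpt, hder⟩ := c.orient_right
    refine ⟨θ, k, hk, ?_, ?_⟩
    · rw [← h₂]; exact congrArg φ hpt
    · have h := deriv_coe_comp_eq_smul_fderiv_coe_comp (γ := fun t ↦ K₂ (circlePoint t)) φ.contMDiff
        ((K₂.contMDiff.comp (contDiff_coe_circlePoint.contMDiff.codRestrict_sphere
          fun t ↦ (circlePoint t).2)).mdifferentiableAt hn)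
        (c.contMDiff.mdifferentiableAt hn) hpt hder
      simpa only [h₂, Function.comp_def] using h

end BandCore

end Literature.Topology.FourManifolds
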